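import Summits.ABC.ABC.Theorems.SomeWindowSaving.Negative.WindowSavingBelowThird
import Summits.ABC.ABC.Theorems.SomeWindowSaving.Negative.CMFamily

/-!
# Hypothesis mutation: the crux without the CM-`j` exclusion `c₄ ≠ 0 ∧ c₆ ≠ 0`

Negative-side analysis for the crux `TwistAmplification.SomeWindowSaving` (stmt-ABC-1976), cdisprove
gen 3.  `windowSetCM κ σ X` (defined in `Negative/CMFamily.lean`) is the crux's set-builder with the
two clauses `c₄ ≠ 0`, `c₆ ≠ 0` DROPPED (so the sextic/quartic-twist families `j = 0`, `j = 1728` are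
admitted), and `SomeWindowSavingWithoutCM` the correspondingly mutated crux.  Findings:

* `not_windowSavingCM_below_half`: for `0 < κ < 5 < σ` the mutated count admits NO saving
  `δ < 1/2` — the `j = 0` family `y² = x³ + ℓ⁵` (`Negative/CMFamily.lean`: reduced minimal models,
  `ℓ² ∣ N ∣ 432 ℓ²`, `M⁺ = 432 ℓ¹⁰`, ratio `→ 5`) alone supplies `≫ √X / log X` members.
* `someWindowSavingWithoutCM_false_below_five`: since the crux's threshold `(σ−κ)/(2σ−6)` is always
  `< 1/2`, the mutated crux has NO witness with `κ < 5 < σ` — whereas the genuine crux is only known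
  to need `κ` outside `(3, 9σ/(2σ+3))` for `σ ≤ 6` (`Negative/LowerLawSmallSigma.lean`).
* The exclusion is nevertheless NOT load-bearing for the TRUTH of this `∃`-crux: high windows
  (`κ` above the weak-Szpiro exponent) stay finite with or without CM curves, so the mutated
  statement is still equivalent to cofinite weak generalized Szpiro (cdisprove calibration);
  it is load-bearing for the `∀σ` target `ModerateWindowCount` and for `SharpModerateLaw`, whose
  windows reach below ratio `5` (route text, triage BUG 1).  This file makes that quantitative.
-/

noncomputable section

open UniqueFactorizationMonoid IsDedekindDomain Real WeierstrassCurve Rat.HeightOneSpectrum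
open Literature.NumberTheory.EllipticCurves

namespace Summit.ABC.ABC.Theorems.SomeWindowSaving.Negative

section CMExclusion

variable {ℓ : ℕ}

/-- A priori bounds in the mutated slice: `|c₄| ≤ R`, `|c₆| ≤ 1729 R`, `R = max (X^σ) 1`
(verbatim the argument of `abs_c₄_c₆_le_of_mem`, which never used `c₄ ≠ 0`). -/
theorem abs_c₄_c₆_le_of_mem_windowSetCM {κ σ X : ℝ} {W : WeierstrassCurve ℤ}
    (h : W ∈ windowSetCM κ σ X) :
    ((|W.c₄| : ℤ) : ℝ) ≤ max (X ^ σ) 1 ∧ ((|W.c₆| : ℤ) : ℝ) ≤ 1729 * max (X ^ σ) 1 := by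
  obtain ⟨hE, -, -, -, -, hNX, -, hM⟩ := h
  set R : ℝ := max (X ^ σ) 1 with hR
  have hR1 : 1 ≤ R := le_max_right _ _
  have hN1 : (1 : ℝ) ≤ (((W.baseChange ℚ).conductorNorm ℤ : ℕ) : ℝ) := by
    exact_mod_cast conductorNorm_pos_holds (W.baseChange ℚ)
  have hNσ : (((W.baseChange ℚ).conductorNorm ℤ : ℕ) : ℝ) ^ σ ≤ R := by
    rcases le_or_gt 0 σ with hσ | hσ
    · exact (Real.rpow_le_rpow (by positivity) hNX hσ).trans (le_max_left _ _)
    · exact (Real.rpow_le_one_of_one_le_of_nonpos hN1 hσ.le).trans (le_max_right _ _)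
  have hM' : ((max |W.Δ| (|W.c₄| ^ 3) : ℤ) : ℝ) ≤ R := hM.trans hNσ
  have hΔ : ((|W.Δ| : ℤ) : ℝ) ≤ R := le_trans (by exact_mod_cast le_max_left _ _) hM'
  have hc₄3 : ((|W.c₄| ^ 3 : ℤ) : ℝ) ≤ R := le_trans (by exact_mod_cast le_max_right _ _) hM'
  have hc₄ : ((|W.c₄| : ℤ) : ℝ) ≤ R :=
    le_trans (by exact_mod_cast abs_le_abs_pow W.c₄ three_ne_zero) hc₄3
  refine ⟨hc₄, ?_⟩
  have hrel : (W.c₆ : ℤ) ^ 2 = W.c₄ ^ 3 - 1728 * W.Δ := by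
    have := W.c_relation
    linarith
  have hsq : ((|W.c₆| : ℤ) : ℝ) ≤ ((W.c₆ ^ 2 : ℤ) : ℝ) := by
    have := abs_le_abs_pow W.c₆ two_ne_zero
    rw [sq_abs] at this
    exact_mod_cast this
  have hc₄3' : ((W.c₄ ^ 3 : ℤ) : ℝ) ≤ R := by
    refine le_trans ?_ hc₄3
    have : W.c₄ ^ 3 ≤ |W.c₄| ^ 3 := by
      calc W.c₄ ^ 3 ≤ |W.c₄ ^ 3| := le_abs_self _
        _ = |W.c₄| ^ 3 := abs_pow _ _
    exact_mod_cast this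
  have hΔ' : -((W.Δ : ℤ) : ℝ) ≤ R := by
    refine le_trans ?_ hΔ
    exact_mod_cast neg_le_abs W.Δ
  calc ((|W.c₆| : ℤ) : ℝ) ≤ ((W.c₆ ^ 2 : ℤ) : ℝ) := hsq
    _ = ((W.c₄ ^ 3 : ℤ) : ℝ) - 1728 * ((W.Δ : ℤ) : ℝ) := by rw [hrel]; push_cast; ring
    _ ≤ R + 1728 * R := by linarith
    _ = 1729 * R := by ring

/-- The mutated slice is finite too (so its `ncard` is an honest count). -/
theorem windowSetCM_finite (κ σ X : ℝ) : (windowSetCM κ σ X).Finite := by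
  set R : ℝ := max (X ^ σ) 1 with hR
  set T : ℤ := ⌈1729 * R⌉ with hT
  have hS : (Set.Icc (0 : ℤ) 1 ×ˢ (Set.Icc (-1 : ℤ) 1 ×ˢ (Set.Icc (0 : ℤ) 1 ×ˢ
      (Set.Icc (-T) T ×ˢ Set.Icc (-T) T)))).Finite :=
    (Set.finite_Icc _ _).prod ((Set.finite_Icc _ _).prod ((Set.finite_Icc _ _).prod
      ((Set.finite_Icc _ _).prod (Set.finite_Icc _ _))))
  refine (hS.preimage covariant_injective.injOn).subset fun W hW ↦ ?_
  obtain ⟨hc₄, hc₆⟩ := abs_c₄_c₆_le_of_mem_windowSetCM hW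
  obtain ⟨-, -, ha₁, ha₃, ha₂, -⟩ := hW
  have hR1 : 1 ≤ R := le_max_right _ _
  have hTz : ∀ z : ℤ, ((|z| : ℤ) : ℝ) ≤ 1729 * R → -T ≤ z ∧ z ≤ T := by
    intro z hz
    have hzT : |z| ≤ T := by
      have : ((|z| : ℤ) : ℝ) ≤ T := hz.trans (Int.le_ceil _)
      exact_mod_cast this
    exact abs_le.mp hzT
  simp only [Set.mem_preimage, Set.mem_prod, Set.mem_Icc]
  refine ⟨⟨by omega, by omega⟩, ⟨by omega, by omega⟩, ⟨by omega, by omega⟩,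
    hTz _ (hc₄.trans ?_), hTz _ hc₆⟩
  linarith

/-- Exponent bookkeeping, lower edge: `(432 ℓ²)^κ ≤ 432 ℓ¹⁰` for `0 < κ < 5`, `ℓ ≥ ℓ₀(κ)`. -/
theorem cm_lower_ineq {κ : ℝ} (hκ : κ < 5) :
    ∃ ℓ₀ : ℕ, ∀ ℓ : ℕ, ℓ₀ ≤ ℓ → ((432 : ℝ) * (ℓ : ℝ) ^ 2) ^ κ ≤ 432 * (ℓ : ℝ) ^ 10 := by
  set e : ℝ := 10 - 2 * κ with he
  have he0 : 0 < e := by rw [he]; linarith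
  obtain ⟨ℓ₀, hℓ₀⟩ := exists_nat_ge ((432 : ℝ) ^ (κ / e))
  refine ⟨max ℓ₀ 1, fun ℓ hℓ ↦ ?_⟩
  have hl1 : (1 : ℝ) ≤ ℓ := by exact_mod_cast le_of_max_le_right hℓ
  have hl0 : (0 : ℝ) < ℓ := by linarith
  have hℓ₀' : (432 : ℝ) ^ (κ / e) ≤ ℓ := hℓ₀.trans (by exact_mod_cast le_of_max_le_left hℓ)
  have h1 : (432 : ℝ) ^ κ ≤ (ℓ : ℝ) ^ e := by
    have := Real.rpow_le_rpow (by positivity) hℓ₀' he0.le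
    rwa [← Real.rpow_mul (by norm_num), div_mul_cancel₀ _ he0.ne'] at this
  have h2 : ((432 : ℝ) * (ℓ : ℝ) ^ 2) ^ κ = (432 : ℝ) ^ κ * (ℓ : ℝ) ^ (2 * κ) := by
    rw [Real.mul_rpow (by positivity) (by positivity)]
    congr 1
    rw [show ((ℓ : ℝ) ^ 2 : ℝ) = (ℓ : ℝ) ^ (2 : ℝ) by norm_num, ← Real.rpow_mul hl0.le]
  rw [h2]
  calc (432 : ℝ) ^ κ * (ℓ : ℝ) ^ (2 * κ) ≤ (ℓ : ℝ) ^ e * (ℓ : ℝ) ^ (2 * κ) := by gcongr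
    _ = (ℓ : ℝ) ^ (10 : ℝ) := by rw [← Real.rpow_add hl0]; congr 1; rw [he]; ring
    _ = (ℓ : ℝ) ^ 10 := by norm_num
    _ ≤ 432 * (ℓ : ℝ) ^ 10 := le_mul_of_one_le_left (by positivity) (by norm_num)

/-- Exponent bookkeeping, upper edge: `432 ℓ¹⁰ ≤ (ℓ²)^σ` for `σ > 5`, `ℓ ≥ ℓ₁(σ)`. -/
theorem cm_upper_ineq {σ : ℝ} (hσ : 5 < σ) :
    ∃ ℓ₁ : ℕ, ∀ ℓ : ℕ, ℓ₁ ≤ ℓ → (432 : ℝ) * (ℓ : ℝ) ^ 10 ≤ ((ℓ : ℝ) ^ 2) ^ σ := by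
  set e : ℝ := 2 * σ - 10 with he
  have he0 : 0 < e := by rw [he]; linarith
  obtain ⟨ℓ₁, hℓ₁⟩ := exists_nat_ge ((432 : ℝ) ^ (1 / e))
  refine ⟨max ℓ₁ 1, fun ℓ hℓ ↦ ?_⟩
  have hl1 : (1 : ℝ) ≤ ℓ := by exact_mod_cast le_of_max_le_right hℓ
  have hl0 : (0 : ℝ) < ℓ := by linarith
  have hℓ₁' : (432 : ℝ) ^ (1 / e) ≤ ℓ := hℓ₁.trans (by exact_mod_cast le_of_max_le_left hℓ)
  have h1 : (432 : ℝ) ≤ (ℓ : ℝ) ^ e := by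
    have := Real.rpow_le_rpow (by positivity) hℓ₁' he0.le
    rwa [← Real.rpow_mul (by norm_num), div_mul_cancel₀ _ he0.ne', Real.rpow_one] at this
  have h2 : ((ℓ : ℝ) ^ 2) ^ σ = (ℓ : ℝ) ^ (2 * σ) := by
    rw [show ((ℓ : ℝ) ^ 2 : ℝ) = (ℓ : ℝ) ^ (2 : ℝ) by norm_num, ← Real.rpow_mul hl0.le]
  rw [h2]
  calc (432 : ℝ) * (ℓ : ℝ) ^ 10 = 432 * (ℓ : ℝ) ^ (10 : ℝ) := by norm_num
    _ ≤ (ℓ : ℝ) ^ e * (ℓ : ℝ) ^ (10 : ℝ) := by gcongr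
    _ = (ℓ : ℝ) ^ (2 * σ) := by rw [← Real.rpow_add hl0]; congr 1; rw [he]; ring

/-- **The `j = 0` family sits in every mutated window `[κ, σ] ∋ 5`:** for `0 < κ < 5 < σ` there is
`ℓ₀ ≥ 5` such that for every prime `ℓ ≥ ℓ₀` and every `X ≥ 432 ℓ²`, `cmFamily ℓ ∈ windowSetCM κ σ X`. -/
theorem cmFamily_mem_windowSetCM {κ σ : ℝ} (hκ0 : 0 < κ) (hκ : κ < 5) (hσ : 5 < σ) :
    ∃ ℓ₀ : ℕ, 5 ≤ ℓ₀ ∧ ∀ ℓ : ℕ, ℓ.Prime → ℓ₀ ≤ ℓ → ∀ X : ℝ, (432 : ℝ) * (ℓ : ℝ) ^ 2 ≤ X →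
      cmFamily ℓ ∈ windowSetCM κ σ X := by
  obtain ⟨ℓ₀, hℓ₀⟩ := cm_lower_ineq hκ
  obtain ⟨ℓ₁, hℓ₁⟩ := cm_upper_ineq hσ
  refine ⟨max 5 (max ℓ₀ ℓ₁), le_max_left _ _, fun ℓ hℓ hge X hX ↦ ?_⟩
  have h5 : 5 ≤ ℓ := le_of_max_le_left hge
  have hge₀ : ℓ₀ ≤ ℓ := le_of_max_le_left (le_of_max_le_right hge)
  have hge₁ : ℓ₁ ≤ ℓ := le_of_max_le_right (le_of_max_le_right hge)
  haveI hE := isElliptic_cmFamily hℓ.ne_zero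
  obtain ⟨hNge, hNle⟩ := conductorNorm_cmFamily_bounds hℓ h5
  have hM : ((max |(cmFamily ℓ).Δ| (|(cmFamily ℓ).c₄| ^ 3) : ℤ) : ℝ) = 432 * (ℓ : ℝ) ^ 10 := by
    rw [maxInv_cmFamily]; push_cast; ring
  refine ⟨hE, isMinimalAt_cmFamily hℓ h5, Or.inl rfl, Or.inl rfl, Or.inr (Or.inl rfl),
    hNle.trans hX, ?_, ?_⟩
  · rw [hM]
    calc ((((cmFamily ℓ).baseChange ℚ).conductorNorm ℤ : ℕ) : ℝ) ^ κ
        ≤ ((432 : ℝ) * (ℓ : ℝ) ^ 2) ^ κ := Real.rpow_le_rpow (by positivity) hNle hκ0.le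
      _ ≤ 432 * (ℓ : ℝ) ^ 10 := hℓ₀ ℓ hge₀
  · rw [hM]
    calc (432 : ℝ) * (ℓ : ℝ) ^ 10 ≤ ((ℓ : ℝ) ^ 2) ^ σ := hℓ₁ ℓ hge₁
      _ ≤ ((((cmFamily ℓ).baseChange ℚ).conductorNorm ℤ : ℕ) : ℝ) ^ σ :=
          Real.rpow_le_rpow (by positivity) hNge (by linarith)

/-- **Counting.** For `0 < κ < 5 < σ`: every prime `ℓ ∈ [ℓ₀, Y]` contributes a distinct element of
the mutated slice at `X ≥ 432 Y²`. -/
theorem card_primes_le_ncard_windowSetCM {κ σ : ℝ} (hκ0 : 0 < κ) (hκ : κ < 5) (hσ : 5 < σ) :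
    ∃ ℓ₀ : ℕ, 5 ≤ ℓ₀ ∧ ∀ Y : ℕ, ∀ X : ℝ, (432 : ℝ) * (Y : ℝ) ^ 2 ≤ X →
      ((Finset.Icc ℓ₀ Y).filter Nat.Prime).card ≤ (windowSetCM κ σ X).ncard := by
  classical
  obtain ⟨ℓ₀, h5, hmem⟩ := cmFamily_mem_windowSetCM hκ0 hκ hσ
  refine ⟨ℓ₀, h5, fun Y X hX ↦ ?_⟩
  set P := (Finset.Icc ℓ₀ Y).filter Nat.Prime with hP
  have hinj : Set.InjOn cmFamily (P : Set ℕ) := cmFamily_injective.injOn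
  have hsub : ((P.image cmFamily : Finset (WeierstrassCurve ℤ)) : Set (WeierstrassCurve ℤ)) ⊆
      windowSetCM κ σ X := by
    intro W hW
    rw [Finset.coe_image] at hW
    obtain ⟨p, hp, rfl⟩ := hW
    simp only [hP, Finset.coe_filter, Finset.mem_Icc, Set.mem_setOf_eq] at hp
    refine hmem p hp.2 hp.1.1 X (le_trans ?_ hX)
    have : (p : ℝ) ≤ Y := by exact_mod_cast hp.1.2
    gcongr
  calc P.card = (P.image cmFamily).card := (Finset.card_image_of_injOn hinj).symm
    _ = ((P.image cmFamily : Finset (WeierstrassCurve ℤ)) : Set (WeierstrassCurve ℤ)).ncard :=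
        (Set.ncard_coe_finset _).symm
    _ ≤ (windowSetCM κ σ X).ncard := Set.ncard_le_ncard hsub (windowSetCM_finite κ σ X)

/-- **The mutated count has no saving below `1/2` in any window `[κ, σ] ∋ 5`** (unconditional):
`¬ ∃ κ σ δ C, 0 < κ < 5 < σ ∧ δ < 1/2 ∧ ∀ X ≥ 1, #windowSetCM κ σ X ≤ C X^δ` — the `j = 0` curves
`y² = x³ + ℓ⁵` give `≥ π(√(X/432)) − O(1) ≫ √X / log X` members. -/
theorem not_windowSavingCM_below_half :
    ¬ ∃ κ σ δ C : ℝ, 0 < κ ∧ κ < 5 ∧ 5 < σ ∧ δ < 1 / 2 ∧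
        ∀ X : ℝ, 1 ≤ X → ((windowSetCM κ σ X).ncard : ℝ) ≤ C * X ^ δ := by
  rintro ⟨κ, σ, δ, C, hκ0, hκ, hσ, hδ, hcount⟩
  obtain ⟨p₀, -, hcard⟩ := card_primes_le_ncard_windowSetCM hκ0 hκ hσ
  set δ' : ℝ := max δ 0 with hδ'
  have hδ'0 : 0 ≤ δ' := le_max_right _ _
  have hδ'lt : δ' < 1 / 2 := max_lt hδ (by norm_num)
  set C' : ℝ := max C 0 * (432 : ℝ) ^ δ' with hC'
  have hC'0 : 0 ≤ C' := by positivity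
  set r : ℝ := (1 - 2 * δ') / 2 with hr
  have hr0 : 0 < r := by rw [hr]; linarith
  set c : ℝ := 1 / (8 * (C' + p₀ + 1)) with hc
  have hc0 : 0 < c := by positivity
  obtain ⟨Y₁, hY₁⟩ := Filter.eventually_atTop.mp ((isLittleO_log_rpow_atTop hr0).bound hc0)
  obtain ⟨Y, hY⟩ := exists_nat_ge (max Y₁ 4)
  have hYY₁ : Y₁ ≤ Y := (le_max_left _ _).trans hY
  have hY4 : (4 : ℝ) ≤ Y := (le_max_right _ _).trans hY
  have hY4' : 4 ≤ Y := by exact_mod_cast hY4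
  have hY0 : (0 : ℝ) < Y := by linarith
  have hY1 : (1 : ℝ) ≤ Y := by linarith
  set X : ℝ := (432 : ℝ) * (Y : ℝ) ^ 2 with hX
  have hX1 : 1 ≤ X := by
    rw [hX]
    have : (1 : ℝ) ≤ (Y : ℝ) ^ 2 := one_le_pow₀ hY1
    nlinarith
  -- (1) many primes ⇒ many curves
  have h1 : (Nat.primeCounting Y : ℝ) ≤ ((windowSetCM κ σ X).ncard : ℝ) + p₀ := by
    have := (primeCounting_le_card_add p₀ Y).trans
      (Nat.add_le_add_right (hcard Y X le_rfl) p₀)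
    exact_mod_cast this
  -- (2) the hypothesised saving
  have h2 : ((windowSetCM κ σ X).ncard : ℝ) ≤ C' * (Y : ℝ) ^ (2 * δ') := by
    have hXδ : X ^ δ ≤ X ^ δ' := Real.rpow_le_rpow_of_exponent_le hX1 (le_max_left _ _)
    have e : X ^ δ' = (432 : ℝ) ^ δ' * (Y : ℝ) ^ (2 * δ') := by
      rw [hX, Real.mul_rpow (by positivity) (by positivity)]
      congr 1
      rw [show ((Y : ℝ) ^ 2 : ℝ) = (Y : ℝ) ^ (2 : ℝ) by norm_num, ← Real.rpow_mul hY0.le]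
    calc ((windowSetCM κ σ X).ncard : ℝ) ≤ C * X ^ δ := hcount X hX1
      _ ≤ max C 0 * X ^ δ := by gcongr; exact le_max_left _ _
      _ ≤ max C 0 * X ^ δ' := mul_le_mul_of_nonneg_left hXδ (le_max_right _ _)
      _ = C' * (Y : ℝ) ^ (2 * δ') := by rw [e, hC']; ring
  -- (3) Chebyshev
  have h3 : (Y : ℝ) / (4 * Real.log Y) ≤ Nat.primeCounting Y :=
    Literature.NumberTheory.Sieve.div_four_mul_log_le_primeCounting hY4'
  -- (4) the analysis: C' Y^{2δ'} + p₀ < Y / (4 log Y)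
  have hlogpos : 0 < Real.log Y := Real.log_pos (by linarith)
  have hlogY : Real.log Y ≤ c * (Y : ℝ) ^ r := by
    have := hY₁ Y hYY₁
    rwa [Real.norm_of_nonneg hlogpos.le, Real.norm_of_nonneg (by positivity)] at this
  have h4 : C' * (Y : ℝ) ^ (2 * δ') + p₀ < (Y : ℝ) / (4 * Real.log Y) := by
    rw [lt_div_iff₀ (by positivity)]
    have hY3 : (1 : ℝ) ≤ (Y : ℝ) ^ (2 * δ') := Real.one_le_rpow hY1 (by positivity)
    have hexp : (Y : ℝ) ^ (2 * δ') * (Y : ℝ) ^ r ≤ Y := by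
      rw [← Real.rpow_add hY0]
      calc (Y : ℝ) ^ (2 * δ' + r) ≤ (Y : ℝ) ^ (1 : ℝ) :=
            Real.rpow_le_rpow_of_exponent_le hY1 (by rw [hr]; linarith)
        _ = Y := Real.rpow_one _
    have hcoef : 4 * c * (C' + p₀) < 1 := by
      rw [hc]
      have hpos : (0 : ℝ) < C' + p₀ + 1 := by positivity
      rw [show 4 * (1 / (8 * (C' + ↑p₀ + 1))) * (C' + ↑p₀) = (C' + p₀) / (2 * (C' + p₀ + 1)) by
        field_simp; ring]
      rw [div_lt_one (by positivity)]
      linarith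
    calc (C' * (Y : ℝ) ^ (2 * δ') + p₀) * (4 * Real.log Y)
        ≤ (C' * (Y : ℝ) ^ (2 * δ') + p₀ * (Y : ℝ) ^ (2 * δ')) * (4 * (c * (Y : ℝ) ^ r)) := by
          gcongr
          exact le_mul_of_one_le_right (by positivity) hY3
      _ = 4 * c * (C' + p₀) * ((Y : ℝ) ^ (2 * δ') * (Y : ℝ) ^ r) := by ring
      _ ≤ 4 * c * (C' + p₀) * Y := by gcongr
      _ < 1 * Y := by gcongr
      _ = Y := one_mul _
  linarith

/-- The crux's threshold is `< 1/2` (`3 < κ < σ`). -/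
theorem threshold_lt_half {κ σ : ℝ} (hκ : 3 < κ) (hκσ : κ < σ) :
    (σ - κ) / (2 * σ - 6) < 1 / 2 := by
  have hden : 0 < 2 * σ - 6 := by linarith
  rw [div_lt_iff₀ hden]; nlinarith

/-- **The mutated crux has no witness with `κ < 5 < σ`** (unconditional): without the CM-`j`
exclusion every witness of `∃ κ σ δ C, 3 < κ < σ ∧ δ < (σ−κ)/(2σ−6) ∧ …` needs `κ ≥ 5` or `σ ≤ 5`,
since the threshold is `< 1/2` (`threshold_lt_half`) and `not_windowSavingCM_below_half`. -/
theorem someWindowSavingWithoutCM_false_below_five :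
    ¬ ∃ κ σ δ C : ℝ, 3 < κ ∧ κ < 5 ∧ 5 < σ ∧ δ < (σ - κ) / (2 * σ - 6) ∧
        ∀ X : ℝ, 1 ≤ X → ((windowSetCM κ σ X).ncard : ℝ) ≤ C * X ^ δ := by
  rintro ⟨κ, σ, δ, C, hκ3, hκ5, hσ, hδ, hcount⟩
  exact not_windowSavingCM_below_half ⟨κ, σ, δ, C, by linarith, hκ5, hσ,
    hδ.trans (threshold_lt_half hκ3 (by linarith)), hcount⟩

/-- Witness shape for the mutated crux: any `(κ, σ, δ, C)` with `3 < κ`, `δ` below the crux's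
threshold and the mutated count bound — in particular any witness of `SomeWindowSavingWithoutCM` —
has `5 ≤ κ ∨ σ ≤ 5`. -/
theorem someWindowSavingWithoutCM_witness_shape {κ σ δ C : ℝ} (hκ3 : 3 < κ)
    (hδ : δ < (σ - κ) / (2 * σ - 6))
    (hcount : ∀ X : ℝ, 1 ≤ X → ((windowSetCM κ σ X).ncard : ℝ) ≤ C * X ^ δ) :
    5 ≤ κ ∨ σ ≤ 5 := by
  rcases le_or_gt 5 κ with h | h
  · exact Or.inl h
  rcases le_or_gt σ 5 with h' | h'
  · exact Or.inr h'
  exact absurd ⟨κ, σ, δ, C, hκ3, h, h', hδ, hcount⟩ someWindowSavingWithoutCM_false_below_five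

end CMExclusion

end Summit.ABC.ABC.Theorems.SomeWindowSaving.Negative
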